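import Summits.NavierStokesRegularity.FluidComputer.PalasekTowerHostPacket

/-!
# Host preparation, III: the scaled cut-off and the packet bounds in the cut-off scale

Cell `ns-blowup`, seat `ns-blowup-ecbridge-3` (g0); GROUP C «BRIDGE SUPPORT» of the route
`PalasekTowerBreakdown` (crux `EpisodeBaseG`, item stmt-NavierStokesRegularity-19179, BC3 stub
`host_preparation` = the tree Prop `RungG 0`). LABEL: E–C typing (KERNEL construction). WHAT THIS
IS NOT: not Navier–Stokes evidence — calculus bounds for an explicit cut-off packet on `ℝ³`.

* §1 generic pointwise bounds for the packet of `PalasekTowerHostPacket.lean` in terms of the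
  derivatives of the cut-off `χ` AT THE POINT: `‖packetCorr‖ ≤ κ ‖Dχ‖`,
  `‖packetDefect‖ ≤ κ² C_w (‖Dχ‖ + ‖D²χ‖)`, `‖curl packetDefect‖ ≤ κ³ C_w (‖Dχ‖ + 2‖D²χ‖ + ‖D³χ‖)`
  (`κ = ‖curlCLM‖`, `C_w` the uniform bound on `wave, D wave, D² wave`; Mathlib's Leibniz bound
  `ContinuousLinearMap.norm_iteratedFDeriv_le_of_bilinear_of_le_one` for the rank-one field
  `Dχ ⊗ wave = smulRightL (Dχ) (wave)` and the tree's `norm_curl_le`, `norm_fderiv_curl_le`);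
* §2 the SCALED CUT-OFF `cutoff L = η(·/L)` (`η` a fixed smooth bump, `1` on `B̄(0,1)`, `0` off
  `B(0,2)`): `cutoff L = 1` on `B(0, L)`, support in `B̄(0, 2L)`, `0 ≤ cutoff ≤ 1`, and
  `‖Dⁱ(cutoff L)‖ ≤ K / Lⁱ` for `i ≤ 3`, `L ≥ 1` (chain rule with the dilation `L⁻¹ • id`,
  Mathlib `ContinuousLinearMap.iteratedFDeriv_comp_right`; `K` from compactness — existential);
* §3 consequently the packet `packet λ (cutoff L)` has, for `L ≥ 1`, correction, Beltrami defect and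
  its curl all `≤ K/L` uniformly, and speed `≤ |λ| + K/L` (`packet_scale_bounds`).

All constants are existential; no numerics.

References: A. J. Majda, A. L. Bertozzi, *Vorticity and Incompressible Flow* (CUP 2002), §2.3.2
[cite: MajdaBertozziCUP2002, §2.3.2]; S. Palasek, arXiv:2605.13827 §4 [cite: Palasek2026ElementaryModel, §4].
-/

noncomputable section

namespace Summit.NavierStokesRegularity.FluidComputer.PalasekTowerClayBridge.Host

open Real Set Function Filter Topology InnerProductSpace Metric
open scoped RealInnerProductSpace ContDiff Topology

open Literature.Analysis.FluidPDE

/-- Local notation for physical space `ℝ³ = EuclideanSpace ℝ (Fin 3)`. -/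
local notation "ℝ³" => EuclideanSpace ℝ (Fin 3)

/-! ## §1 Generic pointwise bounds for the packet -/

section GenericBounds

variable {lam : ℝ} {χ : ℝ³ → ℝ}

/-- `‖∇χ × wave‖ ≤ κ ‖Dχ‖` (`‖wave‖ = 1`). [folklore] -/
theorem norm_packetCorr_le (x : ℝ³) : ‖packetCorr lam χ x‖ ≤ ‖curlCLM‖ * ‖fderiv ℝ χ x‖ := by
  unfold packetCorr packetRank
  have h := norm_curlCLM_smulRight_le (fderiv ℝ χ x) (wave lam x)
  rwa [norm_wave, mul_one] at h

/-- **Speed of the packet**: `‖packet x‖ ≤ |λ| |χ x| + κ ‖Dχ(x)‖`. [folklore] -/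
theorem norm_packet_le (hχ : Differentiable ℝ χ) (x : ℝ³) :
    ‖packet lam χ x‖ ≤ |lam| * |χ x| + ‖curlCLM‖ * ‖fderiv ℝ χ x‖ := by
  rw [packet_apply hχ]
  refine (norm_add_le _ _).trans (add_le_add ?_ (norm_packetCorr_le x))
  rw [norm_smul, norm_wave, mul_one, Real.norm_eq_abs, abs_mul]

/-- The rank-one field is the bilinear image `smulRightL (Dχ) (wave)`. [folklore] -/
theorem packetRank_eq_bilinear :
    packetRank lam χ = fun y =>
      ContinuousLinearMap.smulRightL ℝ ℝ³ ℝ³ (fderiv ℝ χ y) (wave lam y) := by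
  funext y
  ext v i
  simp [packetRank]

/-- Leibniz bound of order `1` for the rank-one field. [folklore] -/
theorem norm_iteratedFDeriv_one_packetRank_le (hχ : ContDiff ℝ ∞ χ) (x : ℝ³) :
    ‖iteratedFDeriv ℝ 1 (packetRank lam χ) x‖ ≤
      ‖iteratedFDeriv ℝ 1 χ x‖ * ‖iteratedFDeriv ℝ 1 (wave lam) x‖ +
        ‖iteratedFDeriv ℝ 2 χ x‖ * ‖iteratedFDeriv ℝ 0 (wave lam) x‖ := by
  have hf : ContDiff ℝ ∞ (fderiv ℝ χ) := hχ.fderiv_right (m := ∞) (by exact_mod_cast le_rfl)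
  have h := ContinuousLinearMap.norm_iteratedFDeriv_le_of_bilinear_of_le_one
    (ContinuousLinearMap.smulRightL ℝ ℝ³ ℝ³) hf (contDiff_wave lam) x (n := 1)
    (by norm_cast) ContinuousLinearMap.norm_smulRightL_le
  rw [packetRank_eq_bilinear]
  refine h.trans (le_of_eq ?_)
  simp only [Finset.sum_range_succ, Finset.sum_range_zero, zero_add, Nat.choose_zero_right,
    Nat.choose_self, Nat.cast_one, one_mul, Nat.sub_zero, norm_iteratedFDeriv_fderiv]

/-- Leibniz bound of order `2` for the rank-one field. [folklore] -/
theorem norm_iteratedFDeriv_two_packetRank_le (hχ : ContDiff ℝ ∞ χ) (x : ℝ³) :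
    ‖iteratedFDeriv ℝ 2 (packetRank lam χ) x‖ ≤
      ‖iteratedFDeriv ℝ 1 χ x‖ * ‖iteratedFDeriv ℝ 2 (wave lam) x‖ +
        2 * (‖iteratedFDeriv ℝ 2 χ x‖ * ‖iteratedFDeriv ℝ 1 (wave lam) x‖) +
        ‖iteratedFDeriv ℝ 3 χ x‖ * ‖iteratedFDeriv ℝ 0 (wave lam) x‖ := by
  have hf : ContDiff ℝ ∞ (fderiv ℝ χ) := hχ.fderiv_right (m := ∞) (by exact_mod_cast le_rfl)
  have h := ContinuousLinearMap.norm_iteratedFDeriv_le_of_bilinear_of_le_one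
    (ContinuousLinearMap.smulRightL ℝ ℝ³ ℝ³) hf (contDiff_wave lam) x (n := 2)
    (by norm_cast) ContinuousLinearMap.norm_smulRightL_le
  rw [packetRank_eq_bilinear]
  refine h.trans (le_of_eq ?_)
  simp only [Finset.sum_range_succ, Finset.sum_range_zero, zero_add, Nat.choose_zero_right,
    Nat.choose_self, Nat.cast_one, one_mul, Nat.sub_zero, norm_iteratedFDeriv_fderiv,
    show Nat.choose 2 1 = 2 from rfl, Nat.cast_ofNat]
  ring

/-- `‖D¹ packetCorr‖ ≤ κ ‖D¹ (Dχ ⊗ wave)‖` and `‖D² packetCorr‖ ≤ κ ‖D² (Dχ ⊗ wave)‖`. [folklore] -/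
theorem norm_iteratedFDeriv_packetCorr_le (hχ : ContDiff ℝ ∞ χ) (i : ℕ) (x : ℝ³) :
    ‖iteratedFDeriv ℝ i (packetCorr lam χ) x‖ ≤ ‖curlCLM‖ * ‖iteratedFDeriv ℝ i (packetRank lam χ) x‖ := by
  rw [packetCorr_eq_comp, curlCLM.iteratedFDeriv_comp_left (contDiff_packetRank hχ).contDiffAt
    (i := i) (by exact_mod_cast le_top)]
  exact ContinuousLinearMap.norm_compContinuousMultilinearMap_le _ _

/-- **The Beltrami defect is controlled by `Dχ`, `D²χ`**:
`‖R(x)‖ ≤ κ² C_w (‖Dχ(x)‖ + ‖D²χ(x)‖)` whenever `C_w` bounds `wave, D wave, D² wave`. [folklore] -/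
theorem norm_packetDefect_le (hχ : ContDiff ℝ ∞ χ) {Cw : ℝ}
    (hw : ∀ i, i ≤ 2 → ∀ y : ℝ³, ‖iteratedFDeriv ℝ i (wave lam) y‖ ≤ Cw) (x : ℝ³) :
    ‖packetDefect lam χ x‖ ≤
      ‖curlCLM‖ ^ 2 * Cw * (‖iteratedFDeriv ℝ 1 χ x‖ + ‖iteratedFDeriv ℝ 2 χ x‖) := by
  have hκ : 0 ≤ ‖curlCLM‖ := norm_nonneg curlCLM
  have h1 : ‖packetDefect lam χ x‖ ≤ ‖curlCLM‖ * ‖iteratedFDeriv ℝ 1 (packetCorr lam χ) x‖ := by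
    rw [packetDefect_apply hχ, norm_iteratedFDeriv_one]
    exact norm_curl_le _ _
  have h2 := norm_iteratedFDeriv_packetCorr_le (lam := lam) hχ 1 x
  have h3 := norm_iteratedFDeriv_one_packetRank_le (lam := lam) hχ x
  have hw1 := hw 1 (by norm_num) x
  have hw0 := hw 0 (by norm_num) x
  have hA : 0 ≤ ‖iteratedFDeriv ℝ 1 χ x‖ := norm_nonneg _
  have hB : 0 ≤ ‖iteratedFDeriv ℝ 2 χ x‖ := norm_nonneg _
  have h4 : ‖iteratedFDeriv ℝ 1 (packetRank lam χ) x‖ ≤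
      Cw * (‖iteratedFDeriv ℝ 1 χ x‖ + ‖iteratedFDeriv ℝ 2 χ x‖) := by
    calc _ ≤ _ := h3
      _ ≤ ‖iteratedFDeriv ℝ 1 χ x‖ * Cw + ‖iteratedFDeriv ℝ 2 χ x‖ * Cw :=
          add_le_add (mul_le_mul_of_nonneg_left hw1 hA) (mul_le_mul_of_nonneg_left hw0 hB)
      _ = _ := by ring
  calc ‖packetDefect lam χ x‖ ≤ ‖curlCLM‖ * ‖iteratedFDeriv ℝ 1 (packetCorr lam χ) x‖ := h1
    _ ≤ ‖curlCLM‖ * (‖curlCLM‖ * ‖iteratedFDeriv ℝ 1 (packetRank lam χ) x‖) :=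
        mul_le_mul_of_nonneg_left h2 hκ
    _ ≤ ‖curlCLM‖ * (‖curlCLM‖ * (Cw * (‖iteratedFDeriv ℝ 1 χ x‖ + ‖iteratedFDeriv ℝ 2 χ x‖))) :=
        mul_le_mul_of_nonneg_left (mul_le_mul_of_nonneg_left h4 hκ) hκ
    _ = _ := by ring

/-- **The curl of the Beltrami defect is controlled by `Dχ`, `D²χ`, `D³χ`**:
`‖curl R(x)‖ ≤ κ³ C_w (‖Dχ‖ + 2‖D²χ‖ + ‖D³χ‖)`. [folklore] -/
theorem norm_curl_packetDefect_le (hχ : ContDiff ℝ ∞ χ) {Cw : ℝ}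
    (hw : ∀ i, i ≤ 2 → ∀ y : ℝ³, ‖iteratedFDeriv ℝ i (wave lam) y‖ ≤ Cw) (x : ℝ³) :
    ‖curl (packetDefect lam χ) x‖ ≤
      ‖curlCLM‖ ^ 3 * Cw *
        (‖iteratedFDeriv ℝ 1 χ x‖ + 2 * ‖iteratedFDeriv ℝ 2 χ x‖ + ‖iteratedFDeriv ℝ 3 χ x‖) := by
  have hκ : 0 ≤ ‖curlCLM‖ := norm_nonneg curlCLM
  have e : packetDefect lam χ = curl (packetCorr lam χ) := funext (packetDefect_apply hχ)
  have hC2 : ContDiff ℝ 2 (packetCorr lam χ) := contDiff_infty.1 (contDiff_packetCorr hχ) 2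
  have h1 : ‖curl (packetDefect lam χ) x‖ ≤
      ‖curlCLM‖ * (‖curlCLM‖ * ‖iteratedFDeriv ℝ 2 (packetCorr lam χ) x‖) := by
    rw [e]
    exact (norm_curl_le _ _).trans (mul_le_mul_of_nonneg_left (norm_fderiv_curl_le hC2 x) hκ)
  have h2 := norm_iteratedFDeriv_packetCorr_le (lam := lam) hχ 2 x
  have h3 := norm_iteratedFDeriv_two_packetRank_le (lam := lam) hχ x
  have hw2 := hw 2 le_rfl x
  have hw1 := hw 1 (by norm_num) x
  have hw0 := hw 0 (by norm_num) x
  have hA : 0 ≤ ‖iteratedFDeriv ℝ 1 χ x‖ := norm_nonneg _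
  have hB : 0 ≤ ‖iteratedFDeriv ℝ 2 χ x‖ := norm_nonneg _
  have hC : 0 ≤ ‖iteratedFDeriv ℝ 3 χ x‖ := norm_nonneg _
  have h4 : ‖iteratedFDeriv ℝ 2 (packetRank lam χ) x‖ ≤
      Cw * (‖iteratedFDeriv ℝ 1 χ x‖ + 2 * ‖iteratedFDeriv ℝ 2 χ x‖ + ‖iteratedFDeriv ℝ 3 χ x‖) := by
    calc _ ≤ _ := h3
      _ ≤ ‖iteratedFDeriv ℝ 1 χ x‖ * Cw + 2 * (‖iteratedFDeriv ℝ 2 χ x‖ * Cw) +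
            ‖iteratedFDeriv ℝ 3 χ x‖ * Cw :=
          add_le_add (add_le_add (mul_le_mul_of_nonneg_left hw2 hA)
            (mul_le_mul_of_nonneg_left (mul_le_mul_of_nonneg_left hw1 hB) zero_le_two))
            (mul_le_mul_of_nonneg_left hw0 hC)
      _ = _ := by ring
  calc ‖curl (packetDefect lam χ) x‖
      ≤ ‖curlCLM‖ * (‖curlCLM‖ * ‖iteratedFDeriv ℝ 2 (packetCorr lam χ) x‖) := h1
    _ ≤ ‖curlCLM‖ * (‖curlCLM‖ * (‖curlCLM‖ * ‖iteratedFDeriv ℝ 2 (packetRank lam χ) x‖)) :=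
        mul_le_mul_of_nonneg_left (mul_le_mul_of_nonneg_left h2 hκ) hκ
    _ ≤ ‖curlCLM‖ * (‖curlCLM‖ * (‖curlCLM‖ * (Cw *
          (‖iteratedFDeriv ℝ 1 χ x‖ + 2 * ‖iteratedFDeriv ℝ 2 χ x‖ + ‖iteratedFDeriv ℝ 3 χ x‖)))) :=
        mul_le_mul_of_nonneg_left (mul_le_mul_of_nonneg_left (mul_le_mul_of_nonneg_left h4 hκ) hκ) hκ
    _ = _ := by ring

end GenericBounds

/-! ## §2 The scaled cut-off -/

/-- A fixed smooth bump on `ℝ³`: `1` on `B̄(0,1)`, `0` off `B(0,2)`. [folklore] -/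
def bump : ContDiffBump (0 : ℝ³) := ⟨1, 2, zero_lt_one, one_lt_two⟩

/-- The dilation `x ↦ x / L` as a continuous linear map. [folklore] -/
def dilation (L : ℝ) : ℝ³ →L[ℝ] ℝ³ := (L⁻¹ : ℝ) • ContinuousLinearMap.id ℝ ℝ³

/-- **The scaled cut-off** `cutoff L x = η(x / L)`. [folklore] -/
def cutoff (L : ℝ) : ℝ³ → ℝ := (bump : ℝ³ → ℝ) ∘ ⇑(dilation L)

/-- Unfolding the scaled cut-off. [folklore] -/
theorem cutoff_apply (L : ℝ) (x : ℝ³) : cutoff L x = (bump : ℝ³ → ℝ) ((L⁻¹ : ℝ) • x) := rfl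

/-- The scaled cut-off is smooth. [folklore] -/
theorem contDiff_cutoff (L : ℝ) : ContDiff ℝ ∞ (cutoff L) :=
  bump.contDiff.comp (dilation L).contDiff

/-- The scaled cut-off is differentiable. [folklore] -/
theorem differentiable_cutoff (L : ℝ) : Differentiable ℝ (cutoff L) :=
  (contDiff_cutoff L).differentiable (by simp)

/-- `0 ≤ cutoff L ≤ 1`. [folklore] -/
theorem cutoff_nonneg (L : ℝ) (x : ℝ³) : 0 ≤ cutoff L x := bump.nonneg

/-- `cutoff L ≤ 1`. [folklore] -/
theorem cutoff_le_one (L : ℝ) (x : ℝ³) : cutoff L x ≤ 1 := bump.le_one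

/-- `|cutoff L x| ≤ 1`. [folklore] -/
theorem abs_cutoff_le_one (L : ℝ) (x : ℝ³) : |cutoff L x| ≤ 1 := by
  rw [abs_of_nonneg (cutoff_nonneg L x)]
  exact cutoff_le_one L x

/-- **The plateau**: `cutoff L = 1` on the open ball `B(0, L)` (so eventually near each of its
points). [folklore] -/
theorem eventually_cutoff_eq_one {L : ℝ} (hL : 0 < L) {x : ℝ³} (hx : ‖x‖ < L) :
    ∀ᶠ y in 𝓝 x, cutoff L y = 1 := by
  have hopen : IsOpen (Metric.ball (0 : ℝ³) L) := Metric.isOpen_ball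
  have hxm : x ∈ Metric.ball (0 : ℝ³) L := by rwa [Metric.mem_ball, dist_zero_right]
  filter_upwards [hopen.mem_nhds hxm] with y hy
  rw [Metric.mem_ball, dist_zero_right] at hy
  refine bump.one_of_mem_closedBall ?_
  rw [Metric.mem_closedBall, dist_zero_right]
  show ‖(L⁻¹ : ℝ) • y‖ ≤ 1
  rw [norm_smul, Real.norm_eq_abs, abs_inv, abs_of_pos hL, inv_mul_le_iff₀ hL]
  linarith

/-- Off `B(0, 2L)` the scaled cut-off vanishes. [folklore] -/
theorem cutoff_eq_zero {L : ℝ} (hL : 0 < L) {x : ℝ³} (hx : 2 * L ≤ ‖x‖) : cutoff L x = 0 := by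
  refine bump.zero_of_le_dist ?_
  rw [dist_zero_right]
  show (2 : ℝ) ≤ ‖(L⁻¹ : ℝ) • x‖
  rw [norm_smul, Real.norm_eq_abs, abs_inv, abs_of_pos hL, le_inv_mul_iff₀ hL]
  linarith

/-- **Support**: `tsupport (cutoff L) ⊆ B̄(0, 2L)`. [folklore] -/
theorem tsupport_cutoff_subset {L : ℝ} (hL : 0 < L) :
    tsupport (cutoff L) ⊆ Metric.closedBall (0 : ℝ³) (2 * L) := by
  refine closure_minimal ?_ Metric.isClosed_closedBall
  intro x hx
  rw [Metric.mem_closedBall, dist_zero_right]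
  by_contra h
  exact hx (cutoff_eq_zero hL (le_of_lt (not_le.mp h)))

/-- The scaled cut-off has compact support. [folklore] -/
theorem hasCompactSupport_cutoff {L : ℝ} (hL : 0 < L) : HasCompactSupport (cutoff L) :=
  IsCompact.of_isClosed_subset (isCompact_closedBall _ _) (isClosed_tsupport _)
    (tsupport_cutoff_subset hL)

/-- Off `B̄(0, 2L)` a point is outside the support of the cut-off. [folklore] -/
theorem notMem_tsupport_cutoff {L : ℝ} (hL : 0 < L) {x : ℝ³} (hx : 2 * L < ‖x‖) :
    x ∉ tsupport (cutoff L) := fun h => by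
  have := tsupport_cutoff_subset hL h
  rw [Metric.mem_closedBall, dist_zero_right] at this
  linarith

/-- The dilation has norm `≤ 1/L` for `L > 0`. [folklore] -/
theorem norm_dilation_le {L : ℝ} (hL : 0 < L) : ‖dilation L‖ ≤ L⁻¹ := by
  unfold dilation
  rw [norm_smul, Real.norm_eq_abs, abs_of_pos (inv_pos.2 hL)]
  exact mul_le_of_le_one_right (inv_pos.2 hL).le ContinuousLinearMap.norm_id_le

/-- **Derivative bounds of the scaled cut-off**: `‖Dⁱ(cutoff L)(x)‖ ≤ Kᵢ / Lⁱ` with `Kᵢ` a uniform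
bound on `Dⁱη` (chain rule with the dilation). [folklore] -/
theorem norm_iteratedFDeriv_cutoff_le {L : ℝ} (hL : 0 < L) (i : ℕ) {K : ℝ}
    (hK : ∀ y : ℝ³, ‖iteratedFDeriv ℝ i (bump : ℝ³ → ℝ) y‖ ≤ K) (x : ℝ³) :
    ‖iteratedFDeriv ℝ i (cutoff L) x‖ ≤ K / L ^ i := by
  have hKnn : 0 ≤ K := (norm_nonneg _).trans (hK 0)
  rw [cutoff, (dilation L).iteratedFDeriv_comp_right bump.contDiff x (i := i)
    (by exact_mod_cast le_top)]
  refine (ContinuousMultilinearMap.norm_compContinuousLinearMap_le _ _).trans ?_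
  rw [Finset.prod_const, Finset.card_univ, Fintype.card_fin, div_eq_mul_inv, ← inv_pow]
  exact mul_le_mul (hK _) (pow_le_pow_left₀ (norm_nonneg _) (norm_dilation_le hL) i)
    (pow_nonneg (norm_nonneg _) i) hKnn

/-- Uniform bounds on the derivatives of the fixed bump up to order `3`. [folklore] -/
theorem exists_bound_iteratedFDeriv_bump :
    ∃ K : ℝ, 0 ≤ K ∧ ∀ i, i ≤ 3 → ∀ y : ℝ³, ‖iteratedFDeriv ℝ i (bump : ℝ³ → ℝ) y‖ ≤ K := by
  have hb : ∀ i : ℕ, ∃ C, ∀ y : ℝ³, ‖iteratedFDeriv ℝ i (bump : ℝ³ → ℝ) y‖ ≤ C := fun i =>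
    ((bump.contDiff (n := ⊤)).continuous_iteratedFDeriv
      (by exact_mod_cast le_top)).bounded_above_of_compact_support
      (bump.hasCompactSupport.iteratedFDeriv i)
  choose C hC using hb
  refine ⟨max (max (C 0) (C 1)) (max (C 2) (C 3)) + 0, ?_, fun i hi y => ?_⟩
  · have := (norm_nonneg _).trans (hC 0 0)
    rw [add_zero]
    exact this.trans (le_max_of_le_left (le_max_left _ _))
  · rw [add_zero]
    interval_cases i
    · exact (hC 0 y).trans (le_max_of_le_left (le_max_left _ _))
    · exact (hC 1 y).trans (le_max_of_le_left (le_max_right _ _))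
    · exact (hC 2 y).trans (le_max_of_le_right (le_max_left _ _))
    · exact (hC 3 y).trans (le_max_of_le_right (le_max_right _ _))

/-- **The cut-off scale**: one `K ≥ 0` with `‖Dⁱ(cutoff L)(x)‖ ≤ K / L` for `1 ≤ i ≤ 3`, all
`L ≥ 1` and all `x`. [folklore] -/
theorem exists_cutoff_scale_bound :
    ∃ K : ℝ, 0 ≤ K ∧ ∀ L, 1 ≤ L → ∀ i, 1 ≤ i → i ≤ 3 → ∀ x : ℝ³,
      ‖iteratedFDeriv ℝ i (cutoff L) x‖ ≤ K / L := by
  obtain ⟨K, hK0, hK⟩ := exists_bound_iteratedFDeriv_bump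
  refine ⟨K, hK0, fun L hL i hi1 hi3 x => ?_⟩
  have hLpos : 0 < L := lt_of_lt_of_le zero_lt_one hL
  refine (norm_iteratedFDeriv_cutoff_le hLpos i (hK i hi3) x).trans ?_
  rw [div_le_div_iff₀ (pow_pos hLpos i) hLpos]
  refine mul_le_mul_of_nonneg_left ?_ hK0
  calc L = L ^ 1 := (pow_one L).symm
    _ ≤ L ^ i := pow_le_pow_right₀ hL hi1

/-! ## §3 The packet in the cut-off scale -/

/-- **Packet bounds in the cut-off scale.** For each frequency `λ` there is `K ≥ 0` such that for
every `L ≥ 1` and every `x`, the packet `packet λ (cutoff L)` has speed `≤ |λ| + K/L`, correction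
`≤ K/L`, Beltrami defect `≤ K/L` and curl of the defect `≤ K/L`. [folklore] -/
theorem packet_scale_bounds (lam : ℝ) :
    ∃ K : ℝ, 0 ≤ K ∧ ∀ L, 1 ≤ L → ∀ x : ℝ³,
      ‖packet lam (cutoff L) x‖ ≤ |lam| + K / L ∧
      ‖packetCorr lam (cutoff L) x‖ ≤ K / L ∧
      ‖packetDefect lam (cutoff L) x‖ ≤ K / L ∧
      ‖curl (packetDefect lam (cutoff L)) x‖ ≤ K / L := by
  obtain ⟨Kc, hKc0, hKc⟩ := exists_cutoff_scale_bound
  obtain ⟨Cw, hCw0, hCw⟩ := exists_bound_iteratedFDeriv_wave lam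
  set κ : ℝ := ‖curlCLM‖ with hκ
  have hκ0 : 0 ≤ κ := by rw [hκ]; exact norm_nonneg curlCLM
  -- one constant dominating all four right-hand sides
  refine ⟨κ * Kc + κ ^ 2 * Cw * (2 * Kc) + κ ^ 3 * Cw * (4 * Kc), by positivity,
    fun L hL x => ?_⟩
  have hLpos : 0 < L := lt_of_lt_of_le zero_lt_one hL
  have h1 := hKc L hL 1 le_rfl (by norm_num) x
  have h2 := hKc L hL 2 (by norm_num) (by norm_num) x
  have h3 := hKc L hL 3 (by norm_num) le_rfl x
  have hD : ‖fderiv ℝ (cutoff L) x‖ ≤ Kc / L := by rw [← norm_iteratedFDeriv_one]; exact h1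
  have hsm := contDiff_cutoff L
  have hcorr' : ‖curlCLM‖ * ‖fderiv ℝ (cutoff L) x‖ ≤ κ * Kc / L := by
    rw [mul_div_assoc]
    exact mul_le_mul_of_nonneg_left hD hκ0
  have hcorr : ‖packetCorr lam (cutoff L) x‖ ≤ κ * Kc / L := (norm_packetCorr_le x).trans hcorr'
  have hdef : ‖packetDefect lam (cutoff L) x‖ ≤ κ ^ 2 * Cw * (2 * Kc) / L := by
    refine (norm_packetDefect_le hsm hCw x).trans ?_
    rw [mul_div_assoc]
    refine mul_le_mul_of_nonneg_left ?_ (by positivity)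
    rw [show 2 * Kc / L = Kc / L + Kc / L by ring]
    exact add_le_add h1 h2
  have hcurl : ‖curl (packetDefect lam (cutoff L)) x‖ ≤ κ ^ 3 * Cw * (4 * Kc) / L := by
    refine (norm_curl_packetDefect_le hsm hCw x).trans ?_
    rw [mul_div_assoc]
    refine mul_le_mul_of_nonneg_left ?_ (by positivity)
    rw [show 4 * Kc / L = Kc / L + 2 * (Kc / L) + Kc / L by ring]
    exact add_le_add (add_le_add h1 (mul_le_mul_of_nonneg_left h2 zero_le_two)) h3
  have hK1 : κ * Kc / L ≤ (κ * Kc + κ ^ 2 * Cw * (2 * Kc) + κ ^ 3 * Cw * (4 * Kc)) / L := by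
    gcongr
    nlinarith [mul_nonneg (mul_nonneg (pow_nonneg hκ0 2) hCw0) hKc0,
      mul_nonneg (mul_nonneg (pow_nonneg hκ0 3) hCw0) hKc0]
  have hK2 : κ ^ 2 * Cw * (2 * Kc) / L ≤
      (κ * Kc + κ ^ 2 * Cw * (2 * Kc) + κ ^ 3 * Cw * (4 * Kc)) / L := by
    gcongr
    nlinarith [mul_nonneg hκ0 hKc0, mul_nonneg (mul_nonneg (pow_nonneg hκ0 3) hCw0) hKc0]
  have hK3 : κ ^ 3 * Cw * (4 * Kc) / L ≤
      (κ * Kc + κ ^ 2 * Cw * (2 * Kc) + κ ^ 3 * Cw * (4 * Kc)) / L := by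
    gcongr
    nlinarith [mul_nonneg hκ0 hKc0, mul_nonneg (mul_nonneg (pow_nonneg hκ0 2) hCw0) hKc0]
  refine ⟨?_, hcorr.trans hK1, hdef.trans hK2, hcurl.trans hK3⟩
  refine (norm_packet_le (differentiable_cutoff L) x).trans (add_le_add ?_ (hcorr'.trans hK1))
  exact mul_le_of_le_one_right (abs_nonneg lam) (abs_cutoff_le_one L x)

end Summit.NavierStokesRegularity.FluidComputer.PalasekTowerClayBridge.Host

end
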